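import Summits.CriticalPhenomena.PercolationContinuityZ3.Theorems.Transplant.FKConnectivityAllQArborealAuxDefs
import Summits.CriticalPhenomena.PercolationContinuityZ3.Theorems.Transplant.FKConnectivityAllQClusterDomAssoc
import Summits.CriticalPhenomena.PercolationContinuityZ3.Theorems.PercNearOneGluingAdditiveGluingBystanderCluster
import HarnessLib

/-!
# The arboreal gas — TOOLS for Harris' induction: expectations `E^F_w` as weight quotients, the support lemma, the ONE-POINT
# DECOMPOSITION `E^F_w[h] = μ_w(f ∈ F)·E^F_{w[f↦1]}[h] + μ_w(f ∉ F)·E^F_{w[f↦0]}[h]` (valid also when a revealed measure degenerates),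
# transport of the tree along parameter-1 pairs, and the deterministic base case

Support file (`--supports stmt-CriticalPhenomena-4575`), FK sub-lane `prim-bschramm-fk-1` (gen 9) of the post-continuity programme;
builds on p205010 (kernel theorem, internal audit signed; external expert review pending).  No definitions of statements, no named
facts, no sorries; standard axioms.  Consumed by `…ArborealCluster.lean` (forest-MM ⇒ forest-CA ⇒ `ArborealHubPos`).
The arboreal gas `agMeasure w` is `P_w` conditioned on acyclicity (`…ArborealDefs.lean`); revealing a pair `f` (`setW w f b`,
fk-1 g3) conditions on `f ∈ F` / `f ∉ F`: `agWeight_w(ω)·1{f ∈ ω} = w_f·agWeight_{w[f↦1]}(ω)` and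
`agWeight_w(ω)·1{f ∉ ω} = (1 − w_f)·agWeight_{w[f↦0]}(ω)` pointwise (`agWeight_mul_ind_mem`, `agWeight_mul_ind_not_mem`), whence the
mass-level identities and `agE_opd` with NO positivity hypothesis (a forced cycle makes a revealed measure the junk zero measure, and
the corresponding branch probability vanishes).  `ag_reach_iff_of_support` is fk-1 g3's `reachY_iff_of_support` for the forest support.
[cite: Grimmett2006, Thm. (3.7) (p. 39); §1.5 eq. (1.22) (p. 13)] [cite: AyyerLinussonRavichandran2025, §7 Conj. 7.1 (p. 22)]
-/

noncomputable section

namespace Summit.CriticalPhenomena.PercolationContinuityZ3.Theorems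

namespace FK

open MeasureTheory Set Literature.Probability.LatticeModels Literature.Probability.Percolation
open scoped Classical
open BHK2006 DecisionTree HullPort

variable {V : Type*} [Fintype V] (w : Sym2 V → unitInterval)

/-! ### Expectations under the arboreal gas; support; one-point decomposition -/

/-- `μ^F_w(D) = E^F_w[1_D]`. [cite: Grimmett2006, §1.5 eq. (1.22) (p. 13)] -/
theorem agMeasure_real_eq_agE (D : Set (BondConfig V)) : (agMeasure w).real D = agE w (ind D) := agMeasure_real_eq_sum w D

/-- Expectations only see the support. [folklore] -/
theorem agE_congr_support {h h' : BondConfig V → ℝ} (H : ∀ ω, agMass w ω ≠ 0 → h ω = h' ω) : agE w h = agE w h' := by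
  unfold agE
  refine Finset.sum_congr rfl fun ω _ => ?_
  by_cases hω : agMass w ω = 0
  · rw [hω, zero_mul, zero_mul]
  · rw [H ω hω]

/-- `E^F_w` as a quotient of weight sums. [cite: Grimmett2006, §1.5 eq. (1.22) (p. 13)] -/
theorem agE_eq_sum_div (h : BondConfig V → ℝ) : agE w h = (∑ ω : BondConfig V, agWeight w ω * h ω) / agPartition w := by
  unfold agE agMass; rw [Finset.sum_div]; exact Finset.sum_congr rfl fun ω _ => by ring

/-- `E^F_w[1] = μ(Ω)`. [folklore] -/
theorem agE_one : agE w (fun _ => (1 : ℝ)) = (agMeasure w).real univ := by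
  rw [agMeasure_real_eq_agE]; exact Finset.sum_congr rfl fun ω _ => by rw [ind_of_mem (Set.mem_univ _)]

/-- Splitting the product weight at one pair. [folklore] -/
theorem weight_eq_factor_mul (u : Sym2 V → ℝ) (f : Sym2 V) (ω : BondConfig V) :
    weight u ω = (if f ∈ ω then u f else 1 - u f) * ∏ e ∈ Finset.univ.erase f, (if e ∈ ω then u e else 1 - u e) := by
  unfold weight
  exact (Finset.mul_prod_erase Finset.univ (fun e => if e ∈ ω then u e else 1 - u e) (Finset.mem_univ f)).symm

/-- Off the revealed pair the factors of `w` and `w[f↦b]` agree. [folklore] -/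
theorem prod_erase_setW (f : Sym2 V) (b : Bool) (ω : BondConfig V) :
    ∏ e ∈ Finset.univ.erase f, (if e ∈ ω then ((setW w f b e : unitInterval) : ℝ) else 1 - ((setW w f b e : unitInterval) : ℝ)) =
      ∏ e ∈ Finset.univ.erase f, (if e ∈ ω then (w e : ℝ) else 1 - (w e : ℝ)) := by
  refine Finset.prod_congr rfl fun e he => ?_
  rw [setW_ne w (Finset.ne_of_mem_erase he)]

omit [Fintype V] in
/-- The revealed parameter: `w[f↦1] f = 1`, `w[f↦0] f = 0` (as reals). [folklore] -/
theorem coe_setW_self (f : Sym2 V) (b : Bool) : ((setW w f b f : unitInterval) : ℝ) = if b then 1 else 0 := by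
  unfold setW; rw [Function.update_self]; cases b <;> simp

/-- **Support lemma**: on the support of `μ^F_w`, parameter-1 pairs are present and parameter-0 pairs absent. [folklore] -/
theorem mem_of_agMass_ne_zero {ω : BondConfig V} (hω : agMass w ω ≠ 0) :
    (∀ f, w f = 1 → f ∈ ω) ∧ (∀ f, w f = 0 → f ∉ ω) := by
  have key : ∀ f, ((f ∉ ω ∧ w f = 1) ∨ (f ∈ ω ∧ w f = 0)) → agMass w ω = 0 := by
    intro f hf
    have hzero : weight (fun e => ((w e : unitInterval) : ℝ)) ω = 0 := by
      rw [weight_eq_factor_mul _ f]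
      rcases hf with ⟨hfω, h1⟩ | ⟨hfω, h0⟩
      · rw [if_neg hfω]; simp [h1]
      · rw [if_pos hfω]; simp [h0]
    unfold agMass agWeight
    split_ifs <;> simp [hzero]
  refine ⟨fun f hf => ?_, fun f hf hfω => hω (key f (Or.inr ⟨hfω, hf⟩))⟩
  by_contra hfω
  exact hω (key f (Or.inl ⟨hfω, hf⟩))

/-- **Pointwise one-point identity, present branch**: `agWeight_w(ω)·1{f ∈ ω} = w_f·agWeight_{w[f↦1]}(ω)`. [cite: Grimmett2006, Thm. (3.7) (p. 39)] -/
theorem agWeight_mul_ind_mem (f : Sym2 V) (ω : BondConfig V) :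
    agWeight w ω * ind {ω : BondConfig V | f ∈ ω} ω = (w f : ℝ) * agWeight (setW w f true) ω := by
  by_cases hf : f ∈ ω
  · rw [ind_of_mem (show ω ∈ {ω : BondConfig V | f ∈ ω} from hf), mul_one]
    unfold agWeight
    split_ifs with hF
    · rw [weight_eq_factor_mul _ f, weight_eq_factor_mul (fun e => ((setW w f true e : unitInterval) : ℝ)) f, if_pos hf, if_pos hf,
        prod_erase_setW w f true ω, coe_setW_self]
      simp
    · ring
  · rw [ind_of_not_mem (show ω ∉ {ω : BondConfig V | f ∈ ω} from hf), mul_zero]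
    unfold agWeight
    split_ifs with hF
    · rw [weight_eq_factor_mul _ f, if_neg hf, coe_setW_self]; simp
    · ring

/-- **Pointwise one-point identity, absent branch**: `agWeight_w(ω)·1{f ∉ ω} = (1 − w_f)·agWeight_{w[f↦0]}(ω)`. [cite: Grimmett2006, Thm. (3.7) (p. 39)] -/
theorem agWeight_mul_ind_not_mem (f : Sym2 V) (ω : BondConfig V) :
    agWeight w ω * ind {ω : BondConfig V | f ∉ ω} ω = (1 - (w f : ℝ)) * agWeight (setW w f false) ω := by
  by_cases hf : f ∈ ω
  · rw [ind_of_not_mem (show ω ∉ {ω : BondConfig V | f ∉ ω} from fun h => h hf), mul_zero]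
    unfold agWeight
    split_ifs with hF
    · rw [weight_eq_factor_mul _ f, if_pos hf, coe_setW_self]; simp
    · ring
  · rw [ind_of_mem (show ω ∈ {ω : BondConfig V | f ∉ ω} from hf), mul_one]
    unfold agWeight
    split_ifs with hF
    · rw [weight_eq_factor_mul _ f, weight_eq_factor_mul (fun e => ((setW w f false e : unitInterval) : ℝ)) f, if_neg hf, if_neg hf,
        prod_erase_setW w f false ω, coe_setW_self]
      simp
    · ring

/-- **Mass-level one-point identity** (both branches at once): if `agWeight_w·1_J = c·agWeight_u` pointwise then
`agMass_w·1_J = E^F_w[1_J]·agMass_u` — valid also in the degenerate cases `Z_w = 0`, `Z_u = 0`. [cite: Grimmett2006, Thm. (3.7) (p. 39)] -/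
theorem agMass_mul_ind_of_pointwise {u : Sym2 V → unitInterval} {J : Set (BondConfig V)} {c : ℝ}
    (hpt : ∀ ω, agWeight w ω * ind J ω = c * agWeight u ω) (ω : BondConfig V) :
    agMass w ω * ind J ω = agE w (ind J) * agMass u ω := by
  have hsum : ∑ η : BondConfig V, agWeight w η * ind J η = c * agPartition u := by
    unfold agPartition; rw [Finset.mul_sum]; exact Finset.sum_congr rfl fun η _ => hpt η
  rw [agE_eq_sum_div, hsum]
  unfold agMass
  by_cases hZ : agPartition w = 0
  · rw [hZ, div_zero, div_zero, zero_mul, zero_mul]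
  by_cases hZu : agPartition u = 0
  · have h0 : agWeight u ω = 0 :=
      (Finset.sum_eq_zero_iff_of_nonneg (fun η _ => agWeight_nonneg u η)).1 hZu ω (Finset.mem_univ ω)
    rw [h0, zero_div, mul_zero, div_mul_eq_mul_div, hpt ω, h0, mul_zero, zero_div]
  · rw [div_mul_eq_mul_div, hpt ω]
    field_simp

/-- **One-point decomposition of `E^F_w`** along the pair `f`:
`E^F_w[h] = μ_w(f ∈ F)·E^F_{w[f↦1]}[h] + μ_w(f ∉ F)·E^F_{w[f↦0]}[h]`. [cite: Grimmett2006, Thm. (3.7) (p. 39)] -/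
theorem agE_opd (f : Sym2 V) (h : BondConfig V → ℝ) :
    agE w h = agE w (ind {ω : BondConfig V | f ∈ ω}) * agE (setW w f true) h +
      agE w (ind {ω : BondConfig V | f ∉ ω}) * agE (setW w f false) h := by
  have h1 := agMass_mul_ind_of_pointwise w (agWeight_mul_ind_mem w f)
  have h0 := agMass_mul_ind_of_pointwise w (agWeight_mul_ind_not_mem w f)
  unfold agE
  rw [Finset.mul_sum, Finset.mul_sum, ← Finset.sum_add_distrib]
  refine Finset.sum_congr rfl fun ω _ => ?_
  have hsplit : agMass w ω = agMass w ω * ind {ω : BondConfig V | f ∈ ω} ω + agMass w ω * ind {ω : BondConfig V | f ∉ ω} ω := by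
    by_cases hf : f ∈ ω
    · rw [ind_of_mem (show ω ∈ {ω : BondConfig V | f ∈ ω} from hf),
        ind_of_not_mem (show ω ∉ {ω : BondConfig V | f ∉ ω} from fun h => h hf)]; ring
    · rw [ind_of_not_mem (show ω ∉ {ω : BondConfig V | f ∈ ω} from hf),
        ind_of_mem (show ω ∈ {ω : BondConfig V | f ∉ ω} from hf)]; ring
  have e1 := h1 ω
  have e0 := h0 ω
  unfold agE at e1 e0
  rw [hsplit, add_mul, e1, e0]
  ring

/-- The two branch probabilities add up to `μ(Ω)`. [folklore] -/
theorem agE_ind_mem_add (f : Sym2 V) :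
    agE w (ind {ω : BondConfig V | f ∈ ω}) + agE w (ind {ω : BondConfig V | f ∉ ω}) = (agMeasure w).real univ := by
  rw [← agE_one]; unfold agE; rw [← Finset.sum_add_distrib]
  refine Finset.sum_congr rfl fun ω _ => ?_
  by_cases hf : f ∈ ω
  · rw [ind_of_mem (show ω ∈ {ω : BondConfig V | f ∈ ω} from hf),
      ind_of_not_mem (show ω ∉ {ω : BondConfig V | f ∉ ω} from fun h => h hf)]; ring
  · rw [ind_of_not_mem (show ω ∉ {ω : BondConfig V | f ∈ ω} from hf),
      ind_of_mem (show ω ∈ {ω : BondConfig V | f ∉ ω} from hf)]; ring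

/-- `μ(Ω) ∈ {0, 1}`: `1` if `Z_for ≠ 0`, else `0`. [folklore] -/
theorem agMeasure_real_univ_eq_one_or : (agMeasure w).real univ = 1 ∨ (agMeasure w).real univ = 0 := by
  rw [agMeasure_real_univ]; split_ifs <;> simp

/-- Nonnegativity of `E^F_w` on nonnegative integrands. [folklore] -/
theorem agE_nonneg {h : BondConfig V → ℝ} (hh : ∀ ω, 0 ≤ h ω) : 0 ≤ agE w h :=
  Finset.sum_nonneg fun ω _ => mul_nonneg (agMass_nonneg w ω) (hh ω)

/-- `E^F_w[1_D] ≤ μ(Ω)`. [folklore] -/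
theorem agE_ind_le_univ (D : Set (BondConfig V)) : agE w (ind D) ≤ (agMeasure w).real univ := by
  rw [← agE_one]
  exact Finset.sum_le_sum fun ω _ => mul_le_mul_of_nonneg_left (by
    by_cases h : ω ∈ D
    · rw [ind_of_mem h]
    · rw [ind_of_not_mem h]; exact zero_le_one) (agMass_nonneg w ω)

/-! ### The tree seen from a surely-joined vertex; the deterministic base case -/

/-- On the support of `μ^F_u`, the tree of `x` equals the tree of every `v` joined to `x` by parameter-1 pairs. [folklore] -/
theorem ag_ind_clusterIn_eq_of_oneSet_reachable (u : Sym2 V → unitInterval) {x v : V}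
    (hxv : (openGraph (oneSet u)).Reachable x v) (𝒰 : Set (Set V)) {ω : BondConfig V} (hω : agMass u ω ≠ 0) :
    ind (clusterIn x 𝒰) ω = ind (clusterIn v 𝒰) ω := by
  have hsub : oneSet u ⊆ ω := fun f hf => (mem_of_agMass_ne_zero u hω).1 f hf
  have hR : (openGraph ω).Reachable x v := hxv.mono (openGraph_le hsub)
  have hC := KNPreFKG.openCluster_eq_of_reachable hR
  refine BystanderBHK.ind_congr ?_
  change openCluster ω x ∈ 𝒰 ↔ openCluster ω v ∈ 𝒰
  rw [hC]

/-- **The almost-sure tree.**  If every pair meeting the weight-1 tree `A` of `x` is determined, then on the support of `μ^F_u` the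
vertices joined to `x` are exactly those of `A`. [folklore] -/
theorem ag_reach_iff_of_support (u : Sym2 V → unitInterval) (x : V)
    (hA : ∀ f ∈ cut {x} (oneSet u), u f = 0 ∨ u f = 1) {ω : BondConfig V} (hω : agMass u ω ≠ 0) (z : V) :
    (openGraph ω).Reachable x z ↔ (openGraph (oneSet u)).Reachable x z := by
  -- adapted from fk-1 g3's `reachY_iff_of_support` (the proof only uses the support property)
  obtain ⟨h1, h0⟩ := mem_of_agMass_ne_zero u hω
  have hsub : oneSet u ⊆ ω := fun f hf => h1 f hf
  constructor
  · intro hxz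
    rw [SimpleGraph.reachable_iff_reflTransGen] at hxz
    induction hxz with
    | refl => exact SimpleGraph.Reachable.refl x
    | @tail a b _ hab ih =>
      rw [openGraph_adj] at hab
      have hcut : s(a, b) ∈ cut {x} (oneSet u) := ⟨a, Sym2.mem_mk_left a b, x, rfl, ih⟩
      rcases hA _ hcut with h | h
      · exact absurd hab.1 (h0 _ h)
      · have hadj : (openGraph (oneSet u)).Adj a b := by rw [openGraph_adj]; exact ⟨h, hab.2⟩
        exact ih.trans hadj.reachable
  · exact fun hxz => hxz.mono (openGraph_le hsub)

/-- **Deterministic tree**: if every pair meeting the weight-1 tree `A` of `x` is determined, `μ^F_u(T_x ∈ 𝒰) = 1[A ∈ 𝒰]·μ(Ω)`. [folklore] -/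
theorem ag_real_clusterIn_of_determined (u : Sym2 V → unitInterval) (x : V)
    (hA : ∀ f ∈ cut {x} (oneSet u), u f = 0 ∨ u f = 1) (𝒰 : Set (Set V)) :
    (agMeasure u).real (clusterIn x 𝒰) = ind 𝒰 (openCluster (oneSet u) x) * (agMeasure u).real univ := by
  rw [agMeasure_real_eq_agE, ← agE_one, agE, agE, Finset.mul_sum]
  refine Finset.sum_congr rfl fun ω _ => ?_
  by_cases hω : agMass u ω = 0
  · rw [hω]; ring
  have hC : openCluster ω x = openCluster (oneSet u) x := by
    ext z; exact ag_reach_iff_of_support u x hA hω z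
  rw [show ind (clusterIn x 𝒰) ω = ind 𝒰 (openCluster ω x) from rfl, hC]; ring

end FK

end Summit.CriticalPhenomena.PercolationContinuityZ3.Theorems

end
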